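import Mathlib
import Summits.KontsevichZagierPeriods.Zeta5Search.Elimination.DictPencilFull
import Summits.KontsevichZagierPeriods.Zeta5Search.WedgeDictionaryDictStrata
import HarnessLib

/-!
HONEST FRAMING: systematic search; no irrationality claim unless certified — one-line closures of internally
minted dictionary nodes, by restriction of two landed theorems; no number moves; nothing here is a statement
about ζ(5).

# The refined dictionary nodes hold outright: `DictPencilZero` and gen-1's five strata nodes

fam-elim (class `elim`), gen 26, E-L27 — bookkeeping sequel to `Elimination/DictStarTop.lean` (E-L25:
`dictStar_holds : DictStar`) and `Elimination/DictPencilFull.lean` (E-L26: `dictPencil_holds : DictPencil`).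

Six `@[conjecture]`-tagged nodes of the tree are RESTRICTIONS of gen-1's two dictionary nodes
(`WedgeDictionaryThreeTerm.DictStar`, `DictPencil`), minted as fallback decompositions while those were open:
fam-elim's `Elimination.DictPencilZero` (E-L23, `PencilDescent`: `DictPencil` on the stratum `c_i = 0`) and
gen-1's `WedgeDictionary.DictStarZeroStrata`, `DictStarTopFace`, `DictStarLow`, `DictPencilPosTopFace`,
`DictPencilLevelOneTop` (#13 row 1, `WedgeDictionaryDictStrata`).  Each already carries its restriction lemma
from the parent node (`dictPencilZero_of_dictPencil`; `dictStarZeroStrata_of_dictStar`,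
`dictStarTopFace_of_dictStar`, `dictStarLow_of_dictStar`, `dictPencilPosTopFace_of_dictPencil`,
`dictPencilLevelOneTop_of_dictPencil`), so with E-L25 / E-L26 landed every one of them holds; this file records
the six closures BY NAME, so that no refined dictionary node is left reading as open, and runs #13 row 1's two
strata assemblies on them (shape sanity: they return the parent nodes).

RESULTS: `dictPencilZero_holds : DictPencilZero`; `dictStarZeroStrata_holds`, `dictStarTopFace_holds`,
`dictStarLow_holds`, `dictPencilPosTopFace_holds`, `dictPencilLevelOneTop_holds` (gen-1's five strata nodes).

What this is NOT: anything about `CellStar`, `CellPencil` (the cellular certificate families), `CellBridge` or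
the terminal values — those remain exactly as gen-1 states them; the class verdict is unchanged
(T1 NO / T2 NO / T4 YES).
-/

namespace Summit.KontsevichZagierPeriods.Zeta5Search.Elimination

open Summit.KontsevichZagierPeriods.Zeta5Search.WedgeDictionary

/-! ## 1. fam-elim's thin pencil node -/

/-- **`DictPencilZero` holds** (E-L23's thin node: gen-1's dictionary pencil relation on the stratum `c_i = 0`):
restriction of `dictPencil_holds` (E-L26) by `dictPencilZero_of_dictPencil`. -/
theorem dictPencilZero_holds : DictPencilZero :=
  dictPencilZero_of_dictPencil dictPencil_holds

/-! ## 2. gen-1's strata nodes (#13 row 1) -/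

/-- **`DictStarZeroStrata` holds**: restriction of `dictStar_holds` (E-L25). -/
theorem dictStarZeroStrata_holds : DictStarZeroStrata :=
  dictStarZeroStrata_of_dictStar dictStar_holds

/-- **`DictStarTopFace` holds**: restriction of `dictStar_holds` (E-L25). -/
theorem dictStarTopFace_holds : DictStarTopFace :=
  dictStarTopFace_of_dictStar dictStar_holds

/-- **`DictStarLow` holds** (the finitely many low-level instances `P₀ ≤ 3`): restriction of `dictStar_holds`
(E-L25). -/
theorem dictStarLow_holds : DictStarLow :=
  dictStarLow_of_dictStar dictStar_holds

/-- **`DictPencilPosTopFace` holds**: restriction of `dictPencil_holds` (E-L26). -/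
theorem dictPencilPosTopFace_holds : DictPencilPosTopFace :=
  dictPencilPosTopFace_of_dictPencil dictPencil_holds

/-- **`DictPencilLevelOneTop` holds** (the finitely many level-1 tops): restriction of `dictPencil_holds`
(E-L26). -/
theorem dictPencilLevelOneTop_holds : DictPencilLevelOneTop :=
  dictPencilLevelOneTop_of_dictPencil dictPencil_holds

/-! ## 3. Shape sanity: #13 row 1's strata assemblies run on the closures -/

/-- gen-1's `dictStar_of_strata` returns the parent node `DictStar` from the three STAR closures. -/
example : DictStar :=
  dictStar_of_strata dictStarZeroStrata_holds dictStarTopFace_holds dictStarLow_holds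

/-- gen-1's `dictPencil_of_strata` returns the parent node `DictPencil` from the two PENCIL strata closures and
`dictPencilZero_holds`. -/
example : DictPencil :=
  dictPencil_of_strata dictPencilPosTopFace_holds dictPencilZero_holds dictPencilLevelOneTop_holds

end Summit.KontsevichZagierPeriods.Zeta5Search.Elimination
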